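import Summits.ResolutionOfSingularities.ResolutionOfSingularities.Theorems.PurelyInseparableDim4ResConeFixedPair
import Summits.ResolutionOfSingularities.ResolutionOfSingularities.Theorems.PurelyInseparableDim4ResConeCornerRigidTail
import HarnessLib
import HarnessLib.Audit.Tags

/-!
# Purely inseparable four-folds — LOSS-FREE `e_G ≡ 2` TAILS ARE PAIR TAILS ON A PERMANENT BOUNDARY PAIR
# (K2(p) lane, SLICE C (C11): the reduction feeding `…BinaryPairTail*` / `…LightPairTail`; file-holder res-dim4-p-5 g3)

[OURS · counted 0 · cell `res-dim4-pi` · K2(p) lane (desk WORDS #78 (d), #80 (d), #96 (b), #105 (d)) · seat p-5 g3.]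
Nothing here proves K2(p), `NoIsolatedTrap p p` or resolution of singularities in dimension ≥ 4 / char. `p`.

A tail is LOSS-FREE when no boundary letter is ever translated (`b k i ≠ 0 → (c k).r i = 0`).  On a loss-free
constant-`(d, e_G = 2)` tail of an isolated above-floor witnessed `Step0 p` chain with `x^{r₀} ∣ F₀`:
* `step_r_apply_chart_pos` — the chart letter is a boundary letter of the child: `1 ≤ (c (k+1)).r (j k)` (`= o_k − p`);
* `boundary_persists_of_lossfree` — once `1 ≤ (c t).r i` on the loss-free tail, `1 ≤ (c n).r i` for all `n ≥ t`;
* `satellite_of_change_of_lossfree` — (H1): every letter change of the tail is a satellite step;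
* `exists_pair_of_lossfree` — THE REDUCTION: there are `k₂ ≥ k₀` and letters `a ≠ a′` with `j k ∈ {a, a′}` and
  `1 ≤ (c k).r a`, `1 ≤ (c k).r a′` for all `k ≥ k₂` (FT gives a change, (H1)/(H2) hold on a loss-free tail, and the
  FIXED-PAIR theorem `…FixedPair.chain_letters_in_pair` pins the letters).
So the hypotheses `hletters`, `hbdry`, `hfreeT` of `…CornerTransfer` / `…BinaryPairTail*` are CONSEQUENCES of
loss-freeness; what a slice-C assembly still has to supply on such a tail is lightness (or a heavy-pair exclusion).
[cite: CossartJannsenSaito2020, Thm. 3.10(4), Thm. 3.14, Thm. 9.3] [cite: HauserPerlega2019PRIMS, §2 (transform D′ of D)]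
bears_on: LADDER-RESOLUTION:D157-DOOR2 (res-dim4-pi · K2(p) = `RidgeBudget.NoAboveFloorTrap p p` · slice C).
Supports stmt-ResolutionOfSingularities-16155 (helper).
-/

set_option linter.dupNamespace false -- mandated namespace of this single-conjunct summit

noncomputable section

namespace Summit.ResolutionOfSingularities.ResolutionOfSingularities.Theorems.PIDim4

namespace ResCone

open MvPolynomial Finset
open Literature.AlgebraicGeometry.Resolution
open Literature.AlgebraicGeometry.Resolution.CentreBlowup
open Literature.AlgebraicGeometry.Resolution.Hauser2010
open Literature.AlgebraicGeometry.Resolution.HauserPerlega2019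

variable {K : Type} [Field K]

section LossFree

variable (p : ℕ) [Fact p.Prime] [CharP K p] [DecidableEq K]

omit [CharP K p] in
/-- **The chart letter is a boundary letter of the child**: `1 ≤ (c (k+1)).r (j k)` (it equals `o_k − p ≥ 1` above the
floor). [cite: HauserPerlega2019PRIMS, §2 (transform D′ of D)] -/
theorem step_r_apply_chart_pos {c : ℕ → State K} {j : ℕ → Fin 4} {b : ℕ → Fin 4 → K}
    (hc : ∀ k, IsIsolated p (c k).F ∧ Step0 p (c k) (c (k + 1))) (hw : FreeTail.IsWitnessedChain p c j b)
    (hr0 : ∀ e ∈ (c 0).F.support, (c 0).r ≤ e) (hfloor : ∀ k, ordZero (c k).F ≠ p) (k : ℕ) :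
    1 ≤ (c (k + 1)).r (j k) := by
  obtain ⟨o, ho, hpo, -⟩ := chain_band p hc hfloor k
  have hrk := IsolatedBand.isolated_chain_forall_le hc hr0 k
  rw [(hw k).2.2.2.2, step_r_univ p (j k) (hw k).2.1 (c k) ho hrk, Finsupp.coe_update, Function.update_self]
  omega

omit [CharP K p] in
/-- **An untranslated non-chart letter keeps its multiplicity**: `b k i = 0`, `i ≠ j k` ⇒
`(c (k+1)).r i = (c k).r i`. [cite: HauserPerlega2019PRIMS, §2 (transform D′ of D)] -/
theorem step_r_apply_of_untranslated {c : ℕ → State K} {j : ℕ → Fin 4} {b : ℕ → Fin 4 → K}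
    (hc : ∀ k, IsIsolated p (c k).F ∧ Step0 p (c k) (c (k + 1))) (hw : FreeTail.IsWitnessedChain p c j b)
    (hr0 : ∀ e ∈ (c 0).F.support, (c 0).r ≤ e) (hfloor : ∀ k, ordZero (c k).F ≠ p) {k : ℕ} {i : Fin 4}
    (hij : i ≠ j k) (hbi : b k i = 0) : (c (k + 1)).r i = (c k).r i := by
  obtain ⟨o, ho, -, -⟩ := chain_band p hc hfloor k
  have hrk := IsolatedBand.isolated_chain_forall_le hc hr0 k
  rw [(hw k).2.2.2.2, step_r_univ p (j k) (hw k).2.1 (c k) ho hrk, Finsupp.coe_update, Function.update_of_ne hij,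
    Finsupp.filter_apply, if_pos hbi]

omit [CharP K p] in
/-- **Boundary letters persist on a loss-free tail**: if no boundary letter is translated from `k₀` on and
`1 ≤ (c t).r i` at some `t ≥ k₀`, then `1 ≤ (c n).r i` for every `n ≥ t`. [OURS]
[cite: HauserPerlega2019PRIMS, §2 (transform D′ of D)] -/
theorem boundary_persists_of_lossfree {c : ℕ → State K} {j : ℕ → Fin 4} {b : ℕ → Fin 4 → K}
    (hc : ∀ k, IsIsolated p (c k).F ∧ Step0 p (c k) (c (k + 1))) (hw : FreeTail.IsWitnessedChain p c j b)
    (hr0 : ∀ e ∈ (c 0).F.support, (c 0).r ≤ e) (hfloor : ∀ k, ordZero (c k).F ≠ p) {k₀ : ℕ}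
    (hloss : ∀ k, k₀ ≤ k → ∀ i, b k i ≠ 0 → (c k).r i = 0) {t : ℕ} (ht : k₀ ≤ t) {i : Fin 4}
    (hi : 1 ≤ (c t).r i) : ∀ n, t ≤ n → 1 ≤ (c n).r i := by
  intro n hn
  induction n, hn using Nat.le_induction with
  | base => exact hi
  | succ n hn ih =>
    by_cases hij : i = j n
    · rw [hij]; exact step_r_apply_chart_pos p hc hw hr0 hfloor n
    · have hbi : b n i = 0 := by
        by_contra hbi
        have := hloss n (by omega) i hbi
        omega
      rw [step_r_apply_of_untranslated p hc hw hr0 hfloor hij hbi]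
      exact ih

omit [CharP K p] in
/-- **(H1) on a loss-free tail**: the chart letter of step `k ≥ k₀` is not translated at step `k + 1`; in particular
every letter change of the tail is a SATELLITE step. [OURS] [cite: CossartJannsenSaito2020, Thm. 3.14] -/
theorem apply_chart_eq_zero_of_lossfree {c : ℕ → State K} {j : ℕ → Fin 4} {b : ℕ → Fin 4 → K}
    (hc : ∀ k, IsIsolated p (c k).F ∧ Step0 p (c k) (c (k + 1))) (hw : FreeTail.IsWitnessedChain p c j b)
    (hr0 : ∀ e ∈ (c 0).F.support, (c 0).r ≤ e) (hfloor : ∀ k, ordZero (c k).F ≠ p) {k₀ : ℕ}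
    (hloss : ∀ k, k₀ ≤ k → ∀ i, b k i ≠ 0 → (c k).r i = 0) {k : ℕ} (hk : k₀ ≤ k) : b (k + 1) (j k) = 0 := by
  by_contra hb
  have h0 := hloss (k + 1) (by omega) (j k) hb
  have h1 := step_r_apply_chart_pos p hc hw hr0 hfloor k
  omega

omit [CharP K p] in
/-- (H1) in the shape of `…FixedPair.chain_letters_in_pair`: a change at `k ≥ k₀` is a satellite. [OURS]
[cite: CossartJannsenSaito2020, Thm. 3.14] -/
theorem satellite_of_change_of_lossfree {c : ℕ → State K} {j : ℕ → Fin 4} {b : ℕ → Fin 4 → K}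
    (hc : ∀ k, IsIsolated p (c k).F ∧ Step0 p (c k) (c (k + 1))) (hw : FreeTail.IsWitnessedChain p c j b)
    (hr0 : ∀ e ∈ (c 0).F.support, (c 0).r ≤ e) (hfloor : ∀ k, ordZero (c k).F ≠ p) {k₀ : ℕ}
    (hloss : ∀ k, k₀ ≤ k → ∀ i, b k i ≠ 0 → (c k).r i = 0) {k : ℕ} (hk : k₀ ≤ k) (hchg : j (k + 1) ≠ j k) :
    FreeTail.IsSatellite j b k :=
  ⟨hchg, apply_chart_eq_zero_of_lossfree p hc hw hr0 hfloor hloss hk⟩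

/-- **LOSS-FREE `e_G ≡ 2` TAILS ARE PAIR TAILS ON A PERMANENT BOUNDARY PAIR**: on a loss-free constant-`(d, e_G = 2)`
tail (from `k₀`) of an isolated above-floor witnessed `Step0 p` chain with `x^{r₀} ∣ F₀` there are `k₂ ≥ k₀` and letters
`a ≠ a′` such that from `k₂` on every chart letter is `a` or `a′` and both are boundary letters,
`1 ≤ (c k).r a ∧ 1 ≤ (c k).r a′`; both letters occur as chart letters after `k₀`. [OURS]
[cite: CossartJannsenSaito2020, Thm. 3.10(4), Thm. 3.14, Thm. 9.3] -/
theorem exists_pair_of_lossfree {c : ℕ → State K} {j : ℕ → Fin 4} {b : ℕ → Fin 4 → K}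
    (hc : ∀ k, IsIsolated p (c k).F ∧ Step0 p (c k) (c (k + 1))) (hw : FreeTail.IsWitnessedChain p c j b)
    (hr0 : ∀ e ∈ (c 0).F.support, (c 0).r ≤ e) (hfloor : ∀ k, ordZero (c k).F ≠ p) {k₀ : ℕ} {d : ℕ∞}
    (hshade : ∀ k, k₀ ≤ k → (c k).shade = d) (he : ∀ k, k₀ ≤ k → Module.finrank K (resVertex (c k)) = 2)
    (hloss : ∀ k, k₀ ≤ k → ∀ i, b k i ≠ 0 → (c k).r i = 0) :
    ∃ k₂ a a', k₀ ≤ k₂ ∧ a ≠ a' ∧ (∀ k, k₂ ≤ k → (j k = a ∨ j k = a')) ∧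
      (∀ k, k₂ ≤ k → 1 ≤ (c k).r a ∧ 1 ≤ (c k).r a') ∧
      (∃ k, k₀ ≤ k ∧ j k = a) ∧ (∃ k, k₀ ≤ k ∧ j k = a') := by
  -- a change (FT: a satellite step exists after `k₀`)
  have hsat : ∃ n, k₀ ≤ n ∧ FreeTail.IsSatellite j b n := by
    by_contra h
    push Not at h
    obtain ⟨m, hm⟩ := FreeTailProof.noIsolatedFreeTailAt_self p K c j b k₀ hw h
    exact hm (hc m).1
  obtain ⟨k₁, hk₁, hsat₁⟩ := hsat
  have hchg : j (k₁ + 1) ≠ j k₁ := hsat₁.1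
  -- (H1), (H2) on the loss-free tail, hence the fixed pair
  have H1 : ∀ k, k₀ ≤ k → j (k + 1) ≠ j k → b (k + 1) (j k) = 0 := fun k hk _ =>
    apply_chart_eq_zero_of_lossfree p hc hw hr0 hfloor hloss hk
  have H2 : ∀ a c' : ℕ, k₀ ≤ a → a < c' → j (a + 1) ≠ j a → (∀ τ, a < τ → τ ≤ c' → j τ = j (a + 1)) →
      j (c' + 1) ≠ j c' → b (c' + 1) (j a) = 0 := by
    intro a c' ha hac _ _ _
    by_contra hb
    have h0 := hloss (c' + 1) (by omega) (j a) hb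
    have h1 := boundary_persists_of_lossfree p hc hw hr0 hfloor hloss (t := a + 1) (by omega)
      (step_r_apply_chart_pos p hc hw hr0 hfloor a) (c' + 1) (by omega)
    omega
  have hpair := chain_letters_in_pair p hc hw hr0 hfloor hshade he le_rfl H1 H2 hk₁ hchg
  refine ⟨k₁ + 2, j k₁, j (k₁ + 1), by omega, hchg.symm, fun k hk => hpair k (by omega), fun k hk => ⟨?_, ?_⟩,
    ⟨k₁, hk₁, rfl⟩, ⟨k₁ + 1, by omega, rfl⟩⟩
  · exact boundary_persists_of_lossfree p hc hw hr0 hfloor hloss (t := k₁ + 1) (by omega)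
      (step_r_apply_chart_pos p hc hw hr0 hfloor k₁) k (by omega)
  · exact boundary_persists_of_lossfree p hc hw hr0 hfloor hloss (t := k₁ + 2) (by omega)
      (step_r_apply_chart_pos p hc hw hr0 hfloor (k₁ + 1)) k hk

end LossFree

end ResCone

end Summit.ResolutionOfSingularities.ResolutionOfSingularities.Theorems.PIDim4

end
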